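import Mathlib
import Summits.NavierStokesRegularity.NavierStokesRegularity.Theorems.EulerZoomLiouvillePowerGaugeEulerLiouvilleDiscreteBreather
import Summits.NavierStokesRegularity.NavierStokesRegularity.Theorems.EulerZoomLiouvillePowerGaugeEulerLiouvilleFadingMildPast
import HarnessLib

/-!
# TAME CONTRACTING DISCRETE BREATHERS are trivial (crux `EulerZoomLiouville.PowerGaugeEulerLiouville` = stmt-NavierStokesRegularity-19832;
# line `logtime-breathers` of ns-idea-11 — the discrete twin of its stub T2b, Lagrangian form)

Route `EulerZoomLiouville` (NavierStokesRegularity); extra-width seat ns-ezl-w7 g0 (LEAD ns-typeII-p2 g11).  A DISCRETE BREATHER on a past sub-slab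
`(−∞, T₁)` is a member invariant under ONE element of the breather group, `u(τ, y) = Λ · u(τ − P₀, y/Λ)` (`P₀ > 0`), with no profile in between
(ns-ezl-w4's `…DiscreteBreather`: expanding `Λ < 1` dead by the `A`-gauge, contracting `Λ > 1` dead GIVEN a slice-energy bound, all dead at `ρ = ½`;
«contracting discrete breathers of locally unbounded (infinite) energy stay OPEN for `ρ < ½`»).  For CONTRACTING ratios `Λ > 1` there is no profile
equation and hence no local-energy lever (ns-ezl-w4's breather rigidity needs the exact breather); but the LAGRANGIAN lever of T2b survives
discretisation: iterating the symmetry, `u(τ − nP₀, x) = Λ^{−n} u(τ, Λⁿ x)` (`DiscreteBreather.slice_sub_eq`), so bounds on ONE PERIOD WINDOW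
`τ ∈ [T₁ − P₀, T₁)` propagate to the whole past with the exponential clock `c = log Λ / P₀ > 0`:

* `‖u(τ, ·)‖ ≤ B` on the window ⇒ `‖u(s, ·)‖ ≤ B e^{c(P₀ − T₁)} · e^{cs}` for all `s < T₁` (`DiscreteBreather.norm_le_exp_of_window`);
* `‖∇u(τ, y)‖ ≤ C(1 + ‖y‖)^{−q}` on the window ⇒ `‖∇u(s, x)‖ ≤ C κ^{−q} (1 + e^{−cs}‖x‖)^{−q}`, `κ = e^{c(T₁ − P₀)}`
  (`DiscreteBreather.norm_fderiv_le_of_window`),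

i.e. the member has an EXPONENTIALLY FADING MILD PAST, and ns-ezl-w4's `FadingPast.ae_eq_zero_of_gauge_of_fadingMildPast` (the LEAD's T2b mechanism:
finite backward displacement, null trapped set, pathwise Grönwall) concludes: `DiscreteBreather.ae_eq_zero_of_gauge_of_tameContracting`.
The exact tame breathers `e^{cτ}V(e^{−cτ}y)` (`‖V‖ ≤ B`, `‖∇V(z)‖ ≤ C(1+‖z‖)^{−q}`) are the case `P₀` arbitrary, `Λ = e^{cP₀}`.

* `DiscreteBreather.exists_window` — every `s < T₁` is `τ − nP₀` with `τ ∈ [T₁ − P₀, T₁)`, `n ∈ ℕ`;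
* `DiscreteBreather.pow_eq_exp` — `Λⁿ = e^{c n P₀}`, `c = log Λ / P₀`;
* `DiscreteBreather.norm_le_exp_of_window`, `DiscreteBreather.hasFDerivAt_slice_of_window`, `DiscreteBreather.norm_fderiv_le_of_window`;
* `DiscreteBreather.ae_eq_zero_of_gauge_of_tameContracting` — MEMBER LEVEL.

WHAT THIS IS NOT: not NS, not E — a classical stratum of the crux CLASS 19832 on the MODEL lattice, `--supports` stmt-19832; contracting discrete
breathers that are not tame on a period (or not classical) stay OPEN for `ρ < ½`. [folklore; MajdaBertozziCUP2002 §2.5 (2.115)–(2.117), §4.2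
(4.46)–(4.47); line card `Cruxes/PowerGaugeEulerLiouville/Lines/logtime-breathers.md` T2b/T3/T5]
-/

noncomputable section

-- flat `Theorems/<Route><Decl>…` files of one crux share the namespace of the crux (tree convention: `Summit.<S>.<S>.…`)
set_option linter.dupNamespace false

open MeasureTheory Set Filter Topology Metric Function
open scoped ENNReal NNReal

namespace Summit.NavierStokesRegularity.NavierStokesRegularity.Theorems.PowerGaugeEulerLiouville

open Literature.Analysis Literature.Analysis.FunctionSpaces Literature.Analysis.FluidPDE

namespace DiscreteBreather

variable {u : ℝ → EuclideanSpace ℝ (Fin 3) → EuclideanSpace ℝ (Fin 3)} {p : ℝ → EuclideanSpace ℝ (Fin 3) → ℝ}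
  {T₁ P₀ Λ : ℝ}

/-! ### One period window reaches the whole past -/

/-- **Window decomposition**: for `P₀ > 0` every `s < T₁` is `s = τ − nP₀` with `τ = s + nP₀ ∈ [T₁ − P₀, T₁)`, `n ∈ ℕ`
(`n = ⌈(T₁ − s)/P₀⌉ − 1`). [folklore] -/
theorem exists_window (hP₀ : 0 < P₀) {s : ℝ} (hs : s < T₁) :
    ∃ n : ℕ, T₁ - P₀ ≤ s + n * P₀ ∧ s + n * P₀ < T₁ := by
  set x : ℝ := (T₁ - s) / P₀ with hx
  have hx0 : 0 < x := div_pos (by linarith) hP₀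
  set k : ℕ := ⌈x⌉₊ with hk
  have hk1 : 1 ≤ k := Nat.one_le_iff_ne_zero.2 (Nat.pos_iff_ne_zero.1 (Nat.ceil_pos.2 hx0))
  have hxk : x ≤ (k : ℝ) := Nat.le_ceil x
  have hkx : (k : ℝ) < x + 1 := Nat.ceil_lt_add_one hx0.le
  refine ⟨k - 1, ?_, ?_⟩
  · have hcast : ((k - 1 : ℕ) : ℝ) = (k : ℝ) - 1 := by rw [Nat.cast_sub hk1, Nat.cast_one]
    rw [hcast]
    have h1 : (x - 1) * P₀ ≤ ((k : ℝ) - 1) * P₀ := mul_le_mul_of_nonneg_right (by linarith) hP₀.le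
    have h2 : (x - 1) * P₀ = T₁ - s - P₀ := by rw [hx]; field_simp
    linarith
  · have hcast : ((k - 1 : ℕ) : ℝ) = (k : ℝ) - 1 := by rw [Nat.cast_sub hk1, Nat.cast_one]
    rw [hcast]
    have h1 : ((k : ℝ) - 1) * P₀ < x * P₀ := mul_lt_mul_of_pos_right (by linarith) hP₀
    have h2 : x * P₀ = T₁ - s := by rw [hx]; field_simp
    linarith

/-- The clock of the orbit: `Λⁿ = e^{c n P₀}` with `c = log Λ / P₀` (`Λ > 0`, `P₀ ≠ 0`). [folklore] -/
theorem pow_eq_exp (hΛ : 0 < Λ) (hP₀ : P₀ ≠ 0) (n : ℕ) :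
    Λ ^ n = Real.exp (Real.log Λ / P₀ * (n * P₀)) := by
  rw [show Real.log Λ / P₀ * (n * P₀) = n * Real.log Λ by field_simp, Real.exp_nat_mul, Real.exp_log hΛ]

/-! ### Bounds on one window propagate to the whole past -/

/-- **Velocity envelope from one window**: `u(τ, y) = Λ · u(τ − P₀, y/Λ)` for `τ < T₁` (`P₀ > 0`, `Λ > 1`) and `‖u(τ, ·)‖ ≤ B` for
`τ ∈ [T₁ − P₀, T₁)` ⇒ `‖u(s, x)‖ ≤ B e^{c(P₀ − T₁)} e^{cs}` for all `s < T₁`, `c = log Λ / P₀`. [folklore] -/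
theorem norm_le_exp_of_window (hP₀ : 0 < P₀) (hΛ : 1 < Λ)
    (h : ∀ τ : ℝ, τ < T₁ → ∀ y, u τ y = Λ • u (τ - P₀) (Λ⁻¹ • y))
    {B : ℝ} (hB : ∀ τ : ℝ, T₁ - P₀ ≤ τ → τ < T₁ → ∀ y, ‖u τ y‖ ≤ B)
    {s : ℝ} (hs : s < T₁) (x : EuclideanSpace ℝ (Fin 3)) :
    ‖u s x‖ ≤ B * Real.exp (Real.log Λ / P₀ * (P₀ - T₁)) * Real.exp (Real.log Λ / P₀ * s) := by
  have hΛ0 : 0 < Λ := by linarith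
  set c : ℝ := Real.log Λ / P₀ with hc
  have hc0 : 0 < c := div_pos (Real.log_pos hΛ) hP₀
  obtain ⟨n, hτ1, hτ2⟩ := exists_window (T₁ := T₁) hP₀ hs
  set τ : ℝ := s + n * P₀ with hτ
  have hB0 : 0 ≤ B := (norm_nonneg _).trans (hB τ hτ1 hτ2 0)
  -- the slice along the orbit
  have hslice := slice_sub_eq hP₀.le hΛ0.ne' h n hτ2 x
  rw [inv_inv, show τ - n * P₀ = s by rw [hτ]; ring] at hslice
  have hΛn : 0 < Λ ^ n := pow_pos hΛ0 n
  rw [hslice, norm_smul, norm_inv, Real.norm_of_nonneg hΛn.le]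
  -- `(Λⁿ)⁻¹ = e^{−c(τ − s)} ≤ e^{c(P₀ − T₁)} e^{cs}`
  have hinv : (Λ ^ n)⁻¹ = Real.exp (c * s) * Real.exp (-(c * τ)) := by
    rw [pow_eq_exp hΛ0 hP₀.ne' n, ← Real.exp_neg, ← Real.exp_add]
    congr 1
    rw [hτ]; ring
  have hexp : Real.exp (-(c * τ)) ≤ Real.exp (c * (P₀ - T₁)) := Real.exp_le_exp.2 (by nlinarith)
  rw [hinv]
  calc Real.exp (c * s) * Real.exp (-(c * τ)) * ‖u τ (Λ ^ n • x)‖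
      ≤ Real.exp (c * s) * Real.exp (c * (P₀ - T₁)) * B :=
        mul_le_mul (mul_le_mul_of_nonneg_left hexp (Real.exp_pos _).le) (hB τ hτ1 hτ2 _) (norm_nonneg _)
          (mul_nonneg (Real.exp_pos _).le (Real.exp_pos _).le)
    _ = B * Real.exp (c * (P₀ - T₁)) * Real.exp (c * s) := by ring

/-- **The slice gradient along the orbit**: with `s = τ − nP₀`, `∇u(s, ·)(x) = ∇u(τ, ·)(Λⁿ x)` (`u(τ, ·)` differentiable). [folklore] -/
theorem hasFDerivAt_slice_of_window (hP₀ : 0 < P₀) (hΛ : 0 < Λ)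
    (h : ∀ τ : ℝ, τ < T₁ → ∀ y, u τ y = Λ • u (τ - P₀) (Λ⁻¹ • y))
    (n : ℕ) {τ : ℝ} (hτ : τ < T₁) (hd : Differentiable ℝ (u τ)) (x : EuclideanSpace ℝ (Fin 3)) :
    HasFDerivAt (u (τ - n * P₀)) (fderiv ℝ (u τ) (Λ ^ n • x)) x := by
  have hΛn : Λ ^ n ≠ 0 := pow_ne_zero n hΛ.ne'
  have hus : u (τ - n * P₀) = fun x => (Λ ^ n)⁻¹ • u τ (Λ ^ n • x) := by
    funext x
    have h1 := slice_sub_eq hP₀.le hΛ.ne' h n hτ x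
    rwa [inv_inv] at h1
  rw [hus]
  have h1 : HasFDerivAt (fun y : EuclideanSpace ℝ (Fin 3) => Λ ^ n • y)
      (Λ ^ n • ContinuousLinearMap.id ℝ (EuclideanSpace ℝ (Fin 3))) x :=
    (ContinuousLinearMap.id ℝ (EuclideanSpace ℝ (Fin 3))).hasFDerivAt.const_smul (Λ ^ n)
  have h2 := ((hd (Λ ^ n • x)).hasFDerivAt.comp x h1).const_smul ((Λ ^ n)⁻¹)
  refine h2.congr_fderiv (ContinuousLinearMap.ext fun v => ?_)
  simp only [FunLike.coe_smul, Pi.smul_apply, ContinuousLinearMap.comp_apply, ContinuousLinearMap.id_apply, map_smul,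
    smul_smul, inv_mul_cancel₀ hΛn, one_smul]

/-- **Gradient envelope from one window**: `u(τ, y) = Λ · u(τ − P₀, y/Λ)` for `τ < T₁` (`P₀ > 0`, `Λ > 1`, `T₁ ≤ 0`), slices differentiable,
and `‖∇u(τ, y)‖ ≤ C(1 + ‖y‖)^{−q}` (`q > 0`) for `τ ∈ [T₁ − P₀, T₁)` ⇒ `‖∇u(s, x)‖ ≤ C κ^{−q} (1 + e^{−cs}‖x‖)^{−q}` for all `s < T₁`,
`c = log Λ / P₀`, `κ = e^{c(T₁ − P₀)} ∈ (0, 1]`. [folklore] -/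
theorem norm_fderiv_le_of_window (hP₀ : 0 < P₀) (hΛ : 1 < Λ) (hT₁ : T₁ ≤ 0)
    (h : ∀ τ : ℝ, τ < T₁ → ∀ y, u τ y = Λ • u (τ - P₀) (Λ⁻¹ • y))
    (hd : ∀ τ : ℝ, τ < T₁ → Differentiable ℝ (u τ))
    {C q : ℝ} (hq : 0 < q) (htame : ∀ τ : ℝ, T₁ - P₀ ≤ τ → τ < T₁ → ∀ y, ‖fderiv ℝ (u τ) y‖ ≤ C * (1 + ‖y‖) ^ (-q))
    {s : ℝ} (hs : s < T₁) (x : EuclideanSpace ℝ (Fin 3)) :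
    ‖fderiv ℝ (u s) x‖ ≤ C * Real.exp (Real.log Λ / P₀ * (T₁ - P₀)) ^ (-q) *
      (1 + Real.exp (-(Real.log Λ / P₀ * s)) * ‖x‖) ^ (-q) := by
  have hΛ0 : 0 < Λ := by linarith
  set c : ℝ := Real.log Λ / P₀ with hc
  have hc0 : 0 < c := div_pos (Real.log_pos hΛ) hP₀
  obtain ⟨n, hτ1, hτ2⟩ := exists_window (T₁ := T₁) hP₀ hs
  set τ : ℝ := s + n * P₀ with hτ
  have hC0 : 0 ≤ C := by
    have h0 := htame τ hτ1 hτ2 0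
    rw [norm_zero, add_zero, Real.one_rpow, mul_one] at h0
    exact (norm_nonneg _).trans h0
  -- the gradient along the orbit
  have hder := hasFDerivAt_slice_of_window hP₀ hΛ0 h n hτ2 (hd τ hτ2) x
  rw [show τ - n * P₀ = s by rw [hτ]; ring] at hder
  rw [hder.fderiv]
  refine (htame τ hτ1 hτ2 _).trans ?_
  -- `Λⁿ ≥ κ e^{−cs}`, `κ = e^{c(T₁ − P₀)} ≤ 1`
  set κ : ℝ := Real.exp (c * (T₁ - P₀)) with hκ
  have hκ0 : 0 < κ := Real.exp_pos _
  have hκ1 : κ ≤ 1 := by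
    rw [hκ]; exact Real.exp_le_one_iff.2 (by nlinarith)
  have hΛn : Λ ^ n = Real.exp (-(c * s)) * Real.exp (c * τ) := by
    rw [pow_eq_exp hΛ0 hP₀.ne' n, ← Real.exp_add]
    congr 1
    rw [hτ]; ring
  have hΛge : κ * Real.exp (-(c * s)) ≤ Λ ^ n := by
    rw [hΛn, mul_comm]
    exact mul_le_mul_of_nonneg_left (Real.exp_le_exp.2 (by nlinarith)) (Real.exp_pos _).le
  have hE : 0 < Real.exp (-(c * s)) := Real.exp_pos _
  have hbase : κ * (1 + Real.exp (-(c * s)) * ‖x‖) ≤ 1 + ‖Λ ^ n • x‖ := by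
    rw [norm_smul, Real.norm_of_nonneg (pow_pos hΛ0 n).le]
    have hx := norm_nonneg x
    have h1 : κ * Real.exp (-(c * s)) * ‖x‖ ≤ Λ ^ n * ‖x‖ := mul_le_mul_of_nonneg_right hΛge hx
    nlinarith
  have hpos : 0 < κ * (1 + Real.exp (-(c * s)) * ‖x‖) := by positivity
  have h1 : (1 + ‖Λ ^ n • x‖) ^ (-q) ≤ (κ * (1 + Real.exp (-(c * s)) * ‖x‖)) ^ (-q) :=
    Real.rpow_le_rpow_of_nonpos hpos hbase (by linarith)
  have h2 : (κ * (1 + Real.exp (-(c * s)) * ‖x‖)) ^ (-q) = κ ^ (-q) * (1 + Real.exp (-(c * s)) * ‖x‖) ^ (-q) :=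
    Real.mul_rpow hκ0.le (by positivity)
  calc C * (1 + ‖Λ ^ n • x‖) ^ (-q) ≤ C * (κ ^ (-q) * (1 + Real.exp (-(c * s)) * ‖x‖) ^ (-q)) :=
        mul_le_mul_of_nonneg_left (h1.trans h2.le) hC0
    _ = C * κ ^ (-q) * (1 + Real.exp (-(c * s)) * ‖x‖) ^ (-q) := by ring

/-! ### Member level -/

/-- **TAME CONTRACTING DISCRETE BREATHERS ARE TRIVIAL.**  Crux hypotheses verbatim (`0 < ρ ≤ ½`) + `(u, p)` classical on a past sub-slab
`(−∞, T₁)`, `T₁ ≤ 0` + the discrete breather symmetry `u(τ, y) = Λ · u(τ − P₀, y/Λ)` for `τ < T₁` with `P₀ > 0` and a CONTRACTING ratio `Λ > 1`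
+ TAMENESS ON ONE PERIOD WINDOW: `‖u(τ, y)‖ ≤ B` and `‖∇u(τ, y)‖ ≤ C(1 + ‖y‖)^{−q}` (`q > 0`) for `τ ∈ [T₁ − P₀, T₁)` ⇒ `u = 0` a.e. on
`(−∞, 0) × ℝ³`.  The member has an exponentially fading mild past (`norm_le_exp_of_window`, `norm_fderiv_le_of_window`, clock `c = log Λ / P₀`),
so ns-ezl-w4's `FadingPast.ae_eq_zero_of_gauge_of_fadingMildPast` applies.  (Expanding `Λ < 1`, contracting with a slice-energy bound, and `ρ = ½`:
`…DiscreteBreather`, weak class.) [folklore; line card `Lines/logtime-breathers.md` T2b/T3/T5] -/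
theorem ae_eq_zero_of_gauge_of_tameContracting {ρ : ℝ} (hρ : 0 < ρ) (hρh : ρ ≤ 1 / 2)
    {H : ℝ → EuclideanSpace ℝ (Fin 3) → EuclideanSpace ℝ (Fin 3) →L[ℝ] EuclideanSpace ℝ (Fin 3)} {c₀ : ℝ≥0}
    (hsw : IsSuitableWeakSolutionOn (slab (EuclideanSpace ℝ (Fin 3)) (Iio 0) isOpen_Iio) 0 0 u p)
    (hH : HasWeakSpatialGradientOn (slab (EuclideanSpace ℝ (Fin 3)) (Iio 0) isOpen_Iio) u H)
    (hgauge : ∀ a : ℝ, 0 < a →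
      ENNReal.ofReal (a ^ (2 * ρ)) * cknA a (0 : ℝ × EuclideanSpace ℝ (Fin 3)) u +
          ENNReal.ofReal (a ^ ρ) * cknE a (0 : ℝ × EuclideanSpace ℝ (Fin 3)) H +
        ENNReal.ofReal (a ^ (2 * ρ)) * cknD a (0 : ℝ × EuclideanSpace ℝ (Fin 3)) p ≤ (c₀ : ℝ≥0∞))
    (hT₁ : T₁ ≤ 0) (hcl : IsClassicalEulerSolutionOn (Iio T₁) 0 u p) (hP₀ : 0 < P₀) (hΛ : 1 < Λ)
    (h : ∀ τ : ℝ, τ < T₁ → ∀ y, u τ y = Λ • u (τ - P₀) (Λ⁻¹ • y))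
    {B : ℝ} (hB : ∀ τ : ℝ, T₁ - P₀ ≤ τ → τ < T₁ → ∀ y, ‖u τ y‖ ≤ B)
    (htame : ∃ C q : ℝ, 0 < q ∧ ∀ τ : ℝ, T₁ - P₀ ≤ τ → τ < T₁ → ∀ y, ‖fderiv ℝ (u τ) y‖ ≤ C * (1 + ‖y‖) ^ (-q)) :
    uncurry u =ᵐ[volume.restrict (Iio (0 : ℝ) ×ˢ (univ : Set (EuclideanSpace ℝ (Fin 3))))] 0 := by
  obtain ⟨C, q, hq, htame⟩ := htame
  have hc0 : 0 < Real.log Λ / P₀ := div_pos (Real.log_pos hΛ) hP₀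
  have hd : ∀ τ : ℝ, τ < T₁ → Differentiable ℝ (u τ) := fun τ hτ =>
    (hcl.contDiff_velocity hτ).differentiable (by simp)
  exact FadingPast.ae_eq_zero_of_gauge_of_fadingMildPast hρ hρh hsw hH hgauge hT₁ hcl hc0 hq
    (fun s hs y => norm_le_exp_of_window hP₀ hΛ h hB hs y)
    (fun s hs y => norm_fderiv_le_of_window hP₀ hΛ hT₁ h hd hq htame hs y)

end DiscreteBreather

end Summit.NavierStokesRegularity.NavierStokesRegularity.Theorems.PowerGaugeEulerLiouville

end
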